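import Summits.Parity.BatemanHorn.Theorems.AlmostPrimeZerosSystemLSDRealSegmentLocalMult
import HarnessLib

/-!
# Route `AlmostPrimeZeros`, crux `SystemLSDRealSegment` (stmt-Parity-11292), line
# `beta-thinned-root-kernel`: smooth support of `b` and the finite Euler product (`smoothSupport_eulerProduct`)

For a family `f : Fin k → ℤ[X]`, a real `y` and a smoothness height `S`, put `b = bCoeff f y` and
`P_S = ∏_{p < S} p^{2k}`.  We prove the two identities behind the truncated-statistic law:

* (finite Euler product) for every real `δ`,
  `Σ_{m ∣ P_S} b(m) m^δ = ∏_{p < S} Σ_{ν ≤ 2k} b(p^ν) (p^ν)^δ`: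
  `m ↦ b(m) m^δ` is a multiplicative arithmetic function (`bCoeff_one`, `bCoeff_mul_of_coprime`), hence so
  is its Dirichlet convolution with `ζ`, whose value at the product of the pairwise coprime prime powers
  `p^{2k}` factors (`ArithmeticFunction.IsMultiplicative.map_prod`), and the divisors of `p^{2k}` are the
  `p^ν`, `ν ≤ 2k` (`Nat.sum_divisors_prime_pow`);
* (smooth support) for every `x`, `Σ_{m ≤ x, m S-smooth} b(m) = Σ_{m ∣ P_S, m ≤ x} b(m)`: a divisor of
  `P_S` is a positive `S`-smooth number, and an `S`-smooth `m` NOT dividing `P_S` has a prime exponent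
  `v_p(m) > 2k`, whence `b(m) = b(p^{v_p(m)}) b(m / p^{v_p(m)}) = 0` (`bCoeff_prime_pow_eq_zero`).

Pure finite combinatorics over Mathlib and the line's files
`…/Theorems/AlmostPrimeZerosDefs.lean`, `…/Theorems/AlmostPrimeZerosSystemLSDRealSegmentLocalMult.lean`.

References: H. Halberstam, H.-E. Richert, *Sieve Methods* (1974) §5.3; G. Tenenbaum, *Introduction to
analytic and probabilistic number theory* (2015) III.5; the line card
`Cruxes/SystemLSDRealSegment/Lines/beta-thinned-root-kernel.md`.
-/

open Filter Finset Polynomial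
open scoped BigOperators Topology

namespace Summit.Parity.BatemanHorn.Cruxes.SystemLSDRealSegment.BetaThinnedRootKernel

open Literature.NumberTheory.Sieve

noncomputable section

variable {k : ℕ}

/-! ### The twisted coefficient `m ↦ b(m) m^δ` as a multiplicative arithmetic function -/

/-- `b(0) = 0` (no tuple of positive integers has product `0`). [folklore] -/
theorem bCoeff_zero (f : Fin k → ℤ[X]) (y : ℝ) : bCoeff f y 0 = 0 := by
  rw [bCoeff_eq_sum_finMulAntidiag, Nat.finMulAntidiag_zero_right, Finset.sum_empty]

/-- The twisted coefficient `m ↦ b(m) m^δ` is a multiplicative arithmetic function (`b(1) = 1`,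
`b` multiplicative on coprime arguments, `(mn)^δ = m^δ n^δ`). [folklore] -/
theorem isMultiplicative_bCoeff_rpow (f : Fin k → ℤ[X]) (y δ : ℝ) :
    ArithmeticFunction.IsMultiplicative
      (⟨fun m => bCoeff f y m * (m : ℝ) ^ δ, by simp [bCoeff_zero]⟩ : ArithmeticFunction ℝ) := by
  refine ⟨?_, fun {m n} hmn => ?_⟩
  · show bCoeff f y 1 * ((1 : ℕ) : ℝ) ^ δ = 1
    rw [bCoeff_one, Nat.cast_one, Real.one_rpow, one_mul]
  · show bCoeff f y (m * n) * ((m * n : ℕ) : ℝ) ^ δ =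
      bCoeff f y m * (m : ℝ) ^ δ * (bCoeff f y n * (n : ℝ) ^ δ)
    rw [bCoeff_mul_of_coprime f y hmn, Nat.cast_mul,
      Real.mul_rpow (Nat.cast_nonneg _) (Nat.cast_nonneg _)]
    ring

/-- **Finite Euler product**: `Σ_{m ∣ P_S} b(m) m^δ = ∏_{p < S} Σ_{ν ≤ 2k} b(p^ν) (p^ν)^δ`. [folklore] -/
theorem sum_divisors_bCoeff_rpow_eq_prod (f : Fin k → ℤ[X]) (y δ : ℝ) (S : ℕ) :
    ∑ m ∈ (∏ p ∈ Nat.primesBelow S, p ^ (2 * k)).divisors, bCoeff f y m * (m : ℝ) ^ δ =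
      ∏ p ∈ Nat.primesBelow S, ∑ ν ∈ range (2 * k + 1), bCoeff f y (p ^ ν) * ((p ^ ν : ℕ) : ℝ) ^ δ := by
  have hσ := (isMultiplicative_bCoeff_rpow f y δ).mul
    (ArithmeticFunction.isMultiplicative_zeta.natCast (R := ℝ))
  have hpair : ((Nat.primesBelow S : Finset ℕ) : Set ℕ).Pairwise
      (Function.onFun Nat.Coprime fun p : ℕ => p ^ (2 * k)) :=
    fun p hp q hq hpq => Nat.coprime_pow_primes (2 * k) (2 * k) (Nat.prime_of_mem_primesBelow hp)
      (Nat.prime_of_mem_primesBelow hq) hpq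
  have key := hσ.map_prod (fun p : ℕ => p ^ (2 * k)) (Nat.primesBelow S) hpair
  simp only [ArithmeticFunction.coe_mul_zeta_apply, ArithmeticFunction.coe_mk] at key
  rw [key]
  refine Finset.prod_congr rfl fun p hp => ?_
  rw [Nat.sum_divisors_prime_pow (Nat.prime_of_mem_primesBelow hp)]

/-! ### Smooth support: `S`-smooth numbers off the divisors of `P_S` carry no mass -/

/-- The modulus `P_S = ∏_{p < S} p^{2k}` is nonzero. [folklore] -/
theorem prod_primesBelow_pow_ne_zero (k S : ℕ) : (∏ p ∈ Nat.primesBelow S, p ^ (2 * k)) ≠ 0 :=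
  Finset.prod_ne_zero_iff.2 fun _ hp => pow_ne_zero _ (Nat.prime_of_mem_primesBelow hp).ne_zero

/-- `P_S` is `S`-smooth. [folklore] -/
theorem prod_primesBelow_pow_mem_smoothNumbers (k S : ℕ) :
    (∏ p ∈ Nat.primesBelow S, p ^ (2 * k)) ∈ Nat.smoothNumbers S := by
  rw [Nat.mem_smoothNumbers']
  intro q hq hdvd
  obtain ⟨p, hp, hqp⟩ := (hq.prime.dvd_finsetProd_iff _).1 hdvd
  obtain rfl : q = p :=
    (Nat.prime_dvd_prime_iff_eq hq (Nat.prime_of_mem_primesBelow hp)).1 (hq.dvd_of_dvd_pow hqp)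
  exact Nat.lt_of_mem_primesBelow hp

/-- An `S`-smooth number all of whose prime exponents are `≤ 2k` divides `P_S`. [folklore] -/
theorem dvd_prod_primesBelow_pow {S m : ℕ} (k : ℕ) (hm : m ∈ Nat.smoothNumbers S)
    (hle : ∀ p : ℕ, p.Prime → m.factorization p ≤ 2 * k) :
    m ∣ ∏ p ∈ Nat.primesBelow S, p ^ (2 * k) := by
  have hm0 : m ≠ 0 := Nat.ne_zero_of_mem_smoothNumbers hm
  refine (Nat.factorization_prime_le_iff_dvd hm0 (prod_primesBelow_pow_ne_zero k S)).1 fun p hp => ?_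
  by_cases hpm : p ∣ m
  · have hpS : p ∈ Nat.primesBelow S :=
      Nat.mem_primesBelow.2 ⟨Nat.mem_smoothNumbers'.1 hm p hp hpm, hp⟩
    refine (hp.pow_dvd_iff_le_factorization (prod_primesBelow_pow_ne_zero k S)).1 ?_
    exact (Nat.pow_dvd_pow p (hle p hp)).trans
      (Finset.dvd_prod_of_mem (fun q : ℕ => q ^ (2 * k)) hpS)
  · rw [Nat.factorization_eq_zero_of_not_dvd hpm]
    exact Nat.zero_le _

/-- `b(m) = 0` as soon as some prime exponent of `m` exceeds `2k`
(`m = p^{v_p(m)} · (m / p^{v_p(m)})`, coprime factors, `b(p^ν) = 0` for `ν > 2k`). [folklore] -/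
theorem bCoeff_eq_zero_of_lt_factorization (f : Fin k → ℤ[X]) (y : ℝ) {m p : ℕ} (hp : p.Prime)
    (hlt : 2 * k < m.factorization p) : bCoeff f y m = 0 := by
  have hm0 : m ≠ 0 := by
    rintro rfl
    simp at hlt
  calc bCoeff f y m = bCoeff f y (p ^ m.factorization p * (m / p ^ m.factorization p)) := by
        rw [Nat.ordProj_mul_ordCompl_eq_self]
    _ = 0 := by
        rw [bCoeff_mul_of_coprime f y ((Nat.coprime_ordCompl hp hm0).pow_left _),
          bCoeff_prime_pow_eq_zero f y hp hlt, zero_mul]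

/-- **Smooth support**: `Σ_{m ≤ x, m S-smooth} b(m) = Σ_{m ∣ P_S, m ≤ x} b(m)`. [folklore] -/
theorem sum_smooth_bCoeff_eq_sum_divisors (f : Fin k → ℤ[X]) (y : ℝ) (S x : ℕ) :
    ∑ m ∈ (Icc 1 x).filter (· ∈ Nat.smoothNumbers S), bCoeff f y m =
      ∑ m ∈ ((∏ p ∈ Nat.primesBelow S, p ^ (2 * k)).divisors).filter (· ≤ x), bCoeff f y m := by
  symm
  refine Finset.sum_subset (fun m hm => ?_) (fun m hm hm' => ?_)
  · obtain ⟨hmd, hmx⟩ := Finset.mem_filter.1 hm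
    exact Finset.mem_filter.2 ⟨Finset.mem_Icc.2 ⟨Nat.pos_of_mem_divisors hmd, hmx⟩,
      Nat.mem_smoothNumbers_of_dvd (prod_primesBelow_pow_mem_smoothNumbers k S)
        (Nat.dvd_of_mem_divisors hmd)⟩
  · obtain ⟨hmI, hms⟩ := Finset.mem_filter.1 hm
    by_contra hne
    refine hm' (Finset.mem_filter.2 ⟨Nat.mem_divisors.2 ⟨?_, prod_primesBelow_pow_ne_zero k S⟩,
      (Finset.mem_Icc.1 hmI).2⟩)
    refine dvd_prod_primesBelow_pow k hms fun p hp => ?_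
    by_contra hlt
    exact hne (bCoeff_eq_zero_of_lt_factorization f y hp (not_le.1 hlt))

/-! ### The registered stub -/

/-- **smoothSupport_eulerProduct** (registered stub of the line `beta-thinned-root-kernel`): for every
family `f`, every real `y` and every smoothness height `S`, with `b = bCoeff f y` and
`P_S = ∏_{p < S} p^{2k}`: (1) for every real `δ`, `Σ_{m ∣ P_S} b(m) m^δ = ∏_{p < S} Σ_{ν ≤ 2k} b(p^ν)(p^ν)^δ`
(multiplicativity of `m ↦ b(m) m^δ` over the pairwise coprime prime powers `p^{2k}`); (2) for every `x`,
`Σ_{m ≤ x, m S-smooth} b(m) = Σ_{m ∣ P_S, m ≤ x} b(m)` (an `S`-smooth `m ∤ P_S` has some `v_p(m) > 2k`, so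
`b(m) = 0`). [folklore] -/
theorem smoothSupport_eulerProduct :
    ∀ (k : ℕ) (f : Fin k → ℤ[X]) (y : ℝ) (S : ℕ),
      (∀ δ : ℝ, ∑ m ∈ (∏ p ∈ Nat.primesBelow S, p ^ (2 * k)).divisors, bCoeff f y m * (m : ℝ) ^ δ =
        ∏ p ∈ Nat.primesBelow S, ∑ ν ∈ range (2 * k + 1), bCoeff f y (p ^ ν) * ((p ^ ν : ℕ) : ℝ) ^ δ) ∧
      (∀ x : ℕ, ∑ m ∈ (Icc 1 x).filter (· ∈ Nat.smoothNumbers S), bCoeff f y m =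
        ∑ m ∈ ((∏ p ∈ Nat.primesBelow S, p ^ (2 * k)).divisors).filter (· ≤ x), bCoeff f y m) :=
  fun _ f y S => ⟨fun δ => sum_divisors_bCoeff_rpow_eq_prod f y δ S,
    fun x => sum_smooth_bCoeff_eq_sum_divisors f y S x⟩

end

end Summit.Parity.BatemanHorn.Cruxes.SystemLSDRealSegment.BetaThinnedRootKernel
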